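/- Copyright: the b2b-balaban cell (near-miss cell 7), T⁴-continuum fan-out; row NE7b OWNER lineage `t4-ne7b-p1`
(gen 57) — «WHAT THE END CONSUMES OF `HistRead`: ONE PRODUCT BOUND PER ELEMENTARY TERM».  Released under the licence
of the surrounding project. -/
import Summits.QuantumFields.BalabanUV.T4Continuum.Support.B16HistoryWeightPlugW

/-!
# «WHAT THE END CONSUMES OF `HistRead`»: the displayed identification of M2 brick B enters the (α) chain ONLY through
ONE pointwise product bound per elementary term (and the sign of the curly envelope) — `EtermRead`

Summits-side support leaf of the T⁴-continuum cell (rung (B)+1 on a FINITE torus only; NOT infinite volume, NOT the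
mass gap, NOT the Clay statement; NOT a proof of the spine estimate NE7b — the cell's OWN estimate, NOT PRINTED, NOT
PROVED).  [folklore] one `structure … : Prop` (a hypothesis SHAPE weaker than leaf-04's `HistRead`, NOTHING of Bałaban's
asserted) + Bochner ∕ `Finset.prod` bookkeeping over M1 (`B16HistoryIndexedRepr`: `Repr172R.eterm`, `abs_eterm_le`), M2-A
(`B16HistoryIndexedFamily`: `weight`, `abs_weight_le`), M2 brick B (`B16HistoryInputFamily`: `HistReading`, `HistFactors`,
`levelFactor`, `prod_levelFactor_eq_pedM`, `HistRead`), the owner's `B16HistoryWeightPlug` (`prod_comp_evProd_pedMV`,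
`prod_died_evProd_pedMV`) and leaf-04's `B16HistoryWeightPlugW` (`prod_pow_card_le_live_mul_dead_of_plug`); no `[cite:]`
tag, no `def … : Prop` fact of Bałaban's, zero `sorry`.  B16 = [Balaban1989LargeFieldII]: (1.79) p. 383 («We have obtained
the following inequality …», the product over the components of `Z_j` satisfying (i), (ii)) and p. 384 l. 4–6 «The
expression on the right-hand side of (1.79) is a product of factors coming from the successive renormalization steps.
The product of factors coming from the first j steps is connected with the region Z_j, and can be factorized in
components of Z_j» are quoted as the LOCATOR of a hypothesis shape only; nothing printed is asserted.

WHY.  The (α) records carry H3's price side as the field `hR : HistRead ℛ Φf RA l₀ K₀` (WALL §2 row `reprA reprB`: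
«what stays R is THE identification `HistRead`»): SEVEN displays on M1's INTERNAL operators (`χ01`; the unit-weight
envelopes `tz_le`∕`ty_le`∕`tc_le` of the three operations of a choice; `A'_le`; `Vs_le`; and THE identification
`forest_le`: `wZ · wY ≤ ∏ levelFactor` over the components of the process run on the input read off the choice) with
TWO envelope data `wZ`, `wY` that occur nowhere else.  READ BY LINE, every consumer of `hR` in the tree
(`B16HistoryWeightPlug(W).weight_le_live_mul_dead(_of_plug)`, `B16HistoryPricePlug`, `…SupplyWTVS.abs_wC_eq_of_nonempty`)
uses it through EXACTLY two consequences: (E1) the POINTWISE bound `|eterm a (h, ℓ, c) x| ≤ (∏_{j ≤ K} ∏_{c′ ∈ comp j}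
levelFactor …) · e^{BA} · wC · e^{BV}` (M1's `abs_eterm_le` ∘ `forest_le`), (E2) `0 ≤ wC` at a point of the reference
space (`tc_le` above the unit weight).  This file types that pair as **`EtermRead`** — ONE PRODUCT BOUND PER ELEMENTARY
TERM, the literal shape of (1.79) + p. 384 l. 4–6 «a product of factors coming from the successive renormalization
steps … factorized in components» read onto OUR process — proves `HistRead → EtermRead`, and re-derives the chain's
entry points (M2-B's `weight_le_evProd(_mk)`, leaf-04's `weight_le_live_mul_dead_of_plug`, hence the owner's
`weight_le_live_mul_dead`) from `EtermRead` alone.  So the R-content of H3's price side that the END consumes is ONE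
sentence per read term (+ a sign); M1's internal displays and the data `wZ`, `wY` are eliminable BY WEAKENING (not by
equivalence: `EtermRead` does not recover per-operation envelopes).  A record twin carrying `hE : EtermRead` in place of
`hR : HistRead` («LWE») would re-thread `…SupplyWTVS(W)` ∕ `…PricePlug` through §4 — DESIGNED by this file, NOT
commissioned (FREEZE (0); custodian ∕ leaf-04 ON ASK).

WHAT.  §1 **`structure EtermRead ℛ Φf Rp l₀ K₀ : Prop`** — `eterm_le` (E1) for `|t| ≤ l₀`, `K₀ ≤ K`, `ι ∈ LIdx a`, every
`x`; `wC_nonneg` (E2) for `c ∈ HCs a` GIVEN a point `x : X K`.  §2 **`HistRead.etermRead : HistRead … → EtermRead …`**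
(the `hBx` computation of the plugs, once).  §3 **`EtermRead.weight_le_evProd_mk`** ∕ **`EtermRead.weight_le_evProd`** —
leaf-04's M2-B theorems with `hR` REPLACED by `hE` (conclusions VERBATIM).  §4 **`EtermRead.weight_le_live_mul_dead_of_plug`**
— leaf-04's `B16HistoryWeightPlugW.weight_le_live_mul_dead_of_plug` with `hR` REPLACED by `hE` (conclusion VERBATIM, any
class weight `w`, the ledger a plug) — and a non-exported check that the OWNER's theorem of record
`B16HistoryWeightPlug.weight_le_live_mul_dead` (w = 2^{d+3}) is recovered AT ITS TYPE from `hR.etermRead`.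

HONEST SCOPE.  A WEAKENING of a hypothesis shape and a re-derivation; nothing of Bałaban's asserted, instantiated or
discharged; `EtermRead` is as much a READING of (1.79)∕p. 384 onto OUR process as `HistRead` was — what is gained is its
FORM (one product sentence per elementary term; no per-operation envelopes).  BY-NAME EFFECT ON THE WALL: row
`reprA reprB` ∕ (ID)-price — «what stays R is `HistRead` (7 displays + `wZ`, `wY`)» MAY read «what the END consumes of it
is `EtermRead` (1 display + a sign)» once a record twin re-threads §4 (uncommissioned); until then `hR` stays the field of
record and this file is its located weakening.  R∕T-rows by count UNCHANGED.  NE7b NOT PRINTED ∕ NOT PROVED; spine 0∕9.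
HONEST DEPENDENCY (cell): continuum YM on T⁴ ⇐ BetaPertH ∧ nine spine estimates (0/9 proved); BetaPertH ⇐ (D1) ∧ (D4) ∧
CAP+tail; G-an2-4 gates asym, D1 and NE2/3/4.  This file changes none of it.
-/

open Finset MeasureTheory
open Literature.MathematicalPhysics.QuantumFieldTheory.Balaban1983to89
open Literature.MathematicalPhysics.QuantumFieldTheory.Balaban1983to89.B13ScaleTransfer
open Literature.MathematicalPhysics.QuantumFieldTheory.Balaban1983to89.B16SProfile
open T4PersistenceDictionary T4PrintedShapeBanking T4TaggedShapeBanking T4BankedInduction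
open Summit.QuantumFields.BalabanUV.T4Continuum.HistoryAdmissible
open Summit.QuantumFields.BalabanUV.T4Continuum.HistoryRealise
open Summit.QuantumFields.BalabanUV.T4Continuum.HistoryRealiseWeak
open Summit.QuantumFields.BalabanUV.T4Continuum.HistoryGen
open Summit.QuantumFields.BalabanUV.T4Continuum.HistoryGenealogyExtraction
open Summit.QuantumFields.BalabanUV.T4Continuum.HistoryGenealogyRealise
open Summit.QuantumFields.BalabanUV.T4Continuum.HistoryGenealogyInstantiate
open Summit.QuantumFields.BalabanUV.T4Continuum.HistoryGenealogyPedigree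
open Summit.QuantumFields.BalabanUV.T4Continuum.B16HistoryIndexedRepr
open Summit.QuantumFields.BalabanUV.T4Continuum.HistoryBankingForestVolume
open Summit.QuantumFields.BalabanUV.T4Continuum.HistoryBankingVolumePlug
open Summit.QuantumFields.BalabanUV.T4Continuum.HistoryBankingForestPlug
open Summit.QuantumFields.BalabanUV.T4Continuum.HistoryBankingShrunkLedger
open Summit.QuantumFields.BalabanUV.T4Continuum.HistoryBankingShrunkWitness
open Summit.QuantumFields.BalabanUV.T4Continuum.B16HistoryWeightPlug
open Summit.QuantumFields.BalabanUV.T4Continuum.B16HistoryWeightPlugW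

namespace Summit.QuantumFields.BalabanUV.T4Continuum.B16HistoryEtermRead

noncomputable section

-- the structural `DecidableEq` instance of the concrete tag type `Lab (ℕ × Lab d) (Lab d)` exceeds the default
-- synthesis size (as in `B16HistoryWeightPlug(W)`)
set_option synthInstance.maxSize 1024

variable {DomK : ℕ → Type*} {I : (K : ℕ) → HIndex (DomK K)} {d : ℕ} {X : ℕ → Type*}
  {𝒢 : (K : ℕ) → GoodClass (X K)}

/-! ## §1 `EtermRead`: one product bound per elementary term, and the sign of the curly envelope -/

/-- **`EtermRead` — WHAT THE END CONSUMES OF THE IDENTIFICATION** (HYPOTHESIS SHAPE, weaker than `HistRead`; NOTHING of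
Bałaban's asserted).  Over M2 brick B's reading `ℛ`, factor data `Φf` and M1's per-level operations `Rp K t`, for
`|t| ≤ l₀`, `K ≥ K₀`:
* (E1) `eterm_le` — «THE ELEMENTARY TERM OF A HISTORY CHOICE IS BOUNDED BY THE PRODUCT OF THE PRINTED FACTORS OF ITS
  GENEALOGY FOREST TIMES ITS CURLY WEIGHT»: for `ι = (h, ℓ, c) ∈ LIdx a` and every configuration `x`,
  `|(Rp K t).eterm a ι x| ≤ (∏_{j ≤ K} ∏_{c′ ∈ comp j} levelFactor (runOf K a ι) … K j c′) · (e^{BA K t}·(wC K t a c·e^{BV K t a h ℓ c}))`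
  [(1.79) p. 383; p. 384 l. 4–6 «a product of factors coming from the successive renormalization steps … factorized
  in components of Z_j» — locator only];
* (E2) `wC_nonneg` — the curly envelope of a met curly summand is nonnegative at any point of the reference space.
[folklore] -/
structure EtermRead (ℛ : HistReading I d) (Φf : HistFactors I d) (Rp : (K : ℕ) → ℝ → Repr172R (𝒢 K) (I K)) (l₀ : ℝ)
    (K₀ : ℕ) : Prop where
  /-- (E1) one product bound per elementary term -/
  eterm_le : ∀ K t, |t| ≤ l₀ → K₀ ≤ K → ∀ (a : (I K).Adm), ∀ ι ∈ (I K).LIdx a, ∀ x,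
    |(Rp K t).eterm a ι x| ≤
      (∏ j ∈ Finset.range (K + 1), ∏ c' ∈ (ℛ.runOf K a ι).histM.comp j,
          Φf.levelFactor (ℛ.runOf K a ι).histM (ℛ.runOf K a ι).rnwM K j c') *
        (Real.exp (Φf.BA K t) * (Φf.wC K t a ι.2.2 * Real.exp (Φf.BV K t a ι.1 ι.2.1 ι.2.2)))
  /-- (E2) the curly envelope is nonnegative on met curly summands, given a point of the space -/
  wC_nonneg : ∀ K t, |t| ≤ l₀ → K₀ ≤ K → ∀ (a : (I K).Adm), ∀ c ∈ (I K).HCs a, ∀ _x : X K, 0 ≤ Φf.wC K t a c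

/-! ## §2 `HistRead` implies `EtermRead` (the plugs' pointwise computation, once) -/

/-- **THE IDENTIFICATION OF RECORD IMPLIES `EtermRead`**: (E1) = M1's `abs_eterm_le` at `HistRead`'s six envelope
displays, then `forest_le`; (E2) = `tc_le` above the unit weight's nonnegativity. [folklore] -/
theorem _root_.Summit.QuantumFields.BalabanUV.T4Continuum.B16HistoryIndexedRepr.HistRead.etermRead
    {ℛ : HistReading I d} {Φf : HistFactors I d} {Rp : (K : ℕ) → ℝ → Repr172R (𝒢 K) (I K)} {l₀ : ℝ} {K₀ : ℕ}
    (hR : HistRead ℛ Φf Rp l₀ K₀) : EtermRead ℛ Φf Rp l₀ K₀ where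
  eterm_le := by
    intro K t ht hK a ι hι x
    obtain ⟨h, l, c⟩ := ι
    have hmem : h ∈ (I K).HZs a ∧ l ∈ (I K).HYs a ∧ c ∈ (I K).HCs a := by
      simpa [HIndex.LIdx, Finset.mem_product] using hι
    have hF := hR.forest_le K t ht hK a (h, l, c) hι
    have hwC : 0 ≤ Φf.wC K t a c := (((Rp K t).TC a c).one_nonneg x).trans (hR.tc_le K t ht hK a c hmem.2.2 x)
    have hE : 0 ≤ Real.exp (Φf.BA K t) * (Φf.wC K t a c * Real.exp (Φf.BV K t a h l c)) :=
      mul_nonneg (Real.exp_pos _).le (mul_nonneg hwC (Real.exp_pos _).le)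
    calc |(Rp K t).eterm a (h, l, c) x|
        ≤ Φf.wZ K t a h * (Real.exp (Φf.BA K t) * (Φf.wY K t a l * (Φf.wC K t a c * Real.exp (Φf.BV K t a h l c)))) :=
          (Rp K t).abs_eterm_le a (h, l, c) (fun V => hR.χ01 K t a V) (fun W => hR.tz_le K t ht hK a h hmem.1 W)
            (fun W => hR.ty_le K t ht hK a l hmem.2.1 W) (fun W => hR.tc_le K t ht hK a c hmem.2.2 W)
            (hR.A'_le K t ht hK) (fun W => hR.Vs_le K t ht hK a h l c W) x
      _ = Φf.wZ K t a h * Φf.wY K t a l *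
            (Real.exp (Φf.BA K t) * (Φf.wC K t a c * Real.exp (Φf.BV K t a h l c))) := by ring
      _ ≤ _ := mul_le_mul_of_nonneg_right hF hE
  wC_nonneg := fun K t ht hK a c hc x => (((Rp K t).TC a c).one_nonneg x).trans (hR.tc_le K t ht hK a c hc x)

namespace EtermRead

variable {ℛ : HistReading I d} {Φf : HistFactors I d} {Rp : (K : ℕ) → ℝ → Repr172R (𝒢 K) (I K)} {l₀ : ℝ} {K₀ : ℕ}

/-! ## §3 M2 brick B's weight bounds from `EtermRead` -/

/-- **THE WEIGHT OF A TERM IS BOUNDED BY THE EVENT PRODUCTS ALONG `pedM`'s EVENTS, FROM `EtermRead`** (component form):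
leaf-04's `B16HistoryInputFamily.weight_le_evProd_mk` with `hR : HistRead` REPLACED by `hE : EtermRead`; conclusion
VERBATIM.  (E1) integrated (`abs_weight_le`), then `prod_levelFactor_eq_pedM`. [folklore] -/
theorem weight_le_evProd_mk [∀ K, MeasurableSpace (X K)] (μ : (K : ℕ) → Measure (X K)) [∀ K, IsFiniteMeasure (μ K)]
    (hE : EtermRead ℛ Φf Rp l₀ K₀) {K : ℕ} (hK : K₀ ≤ K) {t : ℝ} (ht : |t| ≤ l₀)
    (a : (I K).Adm) {h : (I K).HZ} {l : (I K).HL} {c : (I K).HC} (hι : (h, l, c) ∈ (I K).LIdx a)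
    (hN : (ℛ.runOf K a (h, l, c)).NewOK)
    (hRm : ∀ t k, (ℛ.runOf K a (h, l, c)).Rm t k ≤ (ℛ.runOf K a (h, l, c)).R t) :
    Repr172R.weight μ Rp t ⟨K, a, (h, l, c)⟩ ≤
      (∏ j ∈ Finset.range (K + 1), ∏ c' ∈ (ℛ.runOf K a (h, l, c)).histM.comp j, Φf.Λ K j ^ (c'.2).card) *
        ((∏ c' ∈ (ℛ.runOf K a (h, l, c)).histM.comp K,
            evProd (Φf.fB K) (Φf.fR K) ((ℛ.runOf K a (h, l, c)).pedM.toPGen id (K, c'))) *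
          ∏ j ∈ Finset.range K, ∏ c' ∈ (ℛ.runOf K a (h, l, c)).histM.died j,
            evProd (Φf.fB K) (Φf.fR K) ((ℛ.runOf K a (h, l, c)).pedM.toPGen id (j, c'))) *
        (Real.exp (Φf.BA K t) * (Φf.wC K t a c * Real.exp (Φf.BV K t a h l c)) * (μ K).real Set.univ) := by
  have hw := Repr172R.abs_weight_le μ Rp t K a (h, l, c) (hE.eterm_le K t ht hK a (h, l, c) hι)
  have hP := Φf.prod_levelFactor_eq_pedM (ℛ.runOf K a (h, l, c)) hN hRm K
  calc Repr172R.weight μ Rp t ⟨K, a, (h, l, c)⟩ ≤ |Repr172R.weight μ Rp t ⟨K, a, (h, l, c)⟩| := le_abs_self _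
    _ ≤ _ := hw
    _ = _ := by rw [hP]; ring

/-- **THE SAME, END FORM** (for `τ ∈ termSet I K`, live product over `inputOf.liveC`, the envelope `rest`): leaf-04's
`weight_le_evProd` with `hR` REPLACED by `hE`; conclusion VERBATIM. [folklore] -/
theorem weight_le_evProd [∀ K, MeasurableSpace (X K)] (μ : (K : ℕ) → Measure (X K)) [∀ K, IsFiniteMeasure (μ K)]
    (hE : EtermRead ℛ Φf Rp l₀ K₀)
    (hN : ∀ K, K₀ ≤ K → ∀ τ ∈ HIndex.termSet I K, (ℛ.inputOf.run K τ).NewOK)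
    (hRm : ∀ K, K₀ ≤ K → ∀ τ ∈ HIndex.termSet I K, ∀ t k, (ℛ.inputOf.run K τ).Rm t k ≤ (ℛ.inputOf.run K τ).R t)
    {K : ℕ} (hK : K₀ ≤ K) {t : ℝ} (ht : |t| ≤ l₀) {τ : HIndex.Idx I} (hτ : τ ∈ HIndex.termSet I K) :
    Repr172R.weight μ Rp t τ ≤
      (∏ j ∈ Finset.range (K + 1), ∏ c ∈ (ℛ.inputOf.run K τ).histM.comp j, Φf.Λ K j ^ (c.2).card) *
        ((∏ c ∈ ℛ.inputOf.liveC K τ, evProd (Φf.fB K) (Φf.fR K) ((ℛ.inputOf.ped K τ).toPGen id c)) *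
          ∏ j ∈ Finset.range K, ∏ c ∈ (ℛ.inputOf.run K τ).histM.died j,
            evProd (Φf.fB K) (Φf.fR K) ((ℛ.inputOf.ped K τ).toPGen id (j, c))) *
        Φf.rest (fun K => (μ K).real Set.univ) t τ := by
  obtain ⟨⟨a, h, l, c⟩, hp, hpe⟩ := Finset.mem_map.mp hτ
  have hτe : τ = ⟨K, a, (h, l, c)⟩ := hpe.symm
  subst hτe
  rw [HistReading.liveC_inputOf, Finset.prod_image fun x _ y _ hxy => (Prod.mk.inj hxy).2]
  exact hE.weight_le_evProd_mk μ hK ht a (Finset.mem_sigma.mp hp).2 (hN K hK _ hτ) (hRm K hK _ hτ)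

/-! ## §4 The END's entry point from `EtermRead`: the weight in the booked-cost currency, any class weight -/

/-- **THE WEIGHT OF A TERM IN THE END's CURRENCY, ANY CLASS WEIGHT, FROM `EtermRead`**: leaf-04's
`B16HistoryWeightPlugW.weight_le_live_mul_dead_of_plug` with `hR : HistRead` REPLACED by `hE : EtermRead`; every other
binder and the conclusion VERBATIM (`weight ≤ LIVE(w) · DEAD · rest` under the pass-V process conditions of the run and
the volume plug `hplug`).  Proof: the plug's, with its pointwise step `hBx` := (E1) + (E2). [folklore] -/
theorem weight_le_live_mul_dead_of_plug [∀ K, MeasurableSpace (X K)] (μ : (K : ℕ) → Measure (X K))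
    [∀ K, IsFiniteMeasure (μ K)] (hE : EtermRead ℛ Φf Rp l₀ K₀) {K : ℕ} (hK : K₀ ≤ K) {t : ℝ} (ht : |t| ≤ l₀)
    (a : (I K).Adm) {h : (I K).HZ} {l : (I K).HL} {c : (I K).HC} (hι : (h, l, c) ∈ (I K).LIdx a)
    (hN : (ℛ.runOf K a (h, l, c)).NewOK)
    (hRm : ∀ t k, (ℛ.runOf K a (h, l, c)).Rm t k ≤ (ℛ.runOf K a (h, l, c)).R t)
    (hRmS : ∀ t k, (ℛ.runOf K a (h, l, c)).Rm t (k + 1) ≤ (ℛ.runOf K a (h, l, c)).R (t + 1))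
    (hRm2 : ∀ t, 2 ≤ (ℛ.runOf K a (h, l, c)).Rm t 1) (hD : (ℛ.runOf K a (h, l, c)).NewDisjoint)
    (hL0 : 0 < (ℛ.runOf K a (h, l, c)).L) {C : T4PrintedShapeBanking.Consts} (w : ℝ)
    (hplug : ∀ x ∈ (ℛ.runOf K a (h, l, c)).histV.comp K,
      Real.exp (treeVol (ℛ.runOf K a (h, l, c)).L (ℛ.runOf K a (h, l, c)).s (fun v => (v : ℝ))
          (ℛ.runOf K a (h, l, c)).pedMV (fun j => Real.log (Φf.Λ K j)) K (K, x)) ≤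
        Real.exp (lifeCost (dictWT Prod.fst (ℛ.runOf K a (h, l, c)).R C.n₁)
            (costT Prod.fst C K (ℛ.runOf K a (h, l, c)).R) ((ℛ.runOf K a (h, l, c)).pedMV.genT (K, x))) *
          Real.exp (birthWT Prod.fst (fun n => w * Real.log (Φf.Λ K n)) ((ℛ.runOf K a (h, l, c)).pedMV.genT (K, x)))) :
    Repr172R.weight μ Rp t ⟨K, a, (h, l, c)⟩ ≤
      (∏ x ∈ (ℛ.runOf K a (h, l, c)).histV.comp K,
          Real.exp (lifeCost (dictWT Prod.fst (ℛ.runOf K a (h, l, c)).R C.n₁)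
              (costT Prod.fst C K (ℛ.runOf K a (h, l, c)).R) ((ℛ.runOf K a (h, l, c)).pedMV.genT (K, x))) *
            Real.exp (birthWT Prod.fst (fun n => w * Real.log (Φf.Λ K n))
              ((ℛ.runOf K a (h, l, c)).pedMV.genT (K, x))) *
            evProd (Φf.fB K) (Φf.fR K) ((ℛ.runOf K a (h, l, c)).pedMV.toPGen id (K, x))) *
        (∏ j ∈ Finset.range K, ∏ x ∈ (ℛ.runOf K a (h, l, c)).histV.died j,
          Real.exp (treeVol (ℛ.runOf K a (h, l, c)).L (ℛ.runOf K a (h, l, c)).s (fun v => (v : ℝ))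
              (ℛ.runOf K a (h, l, c)).pedMV (fun j => Real.log (Φf.Λ K j)) j (j, x)) *
            evProd (Φf.fB K) (Φf.fR K) ((ℛ.runOf K a (h, l, c)).pedMV.toPGen id (j, x))) *
        (Real.exp (Φf.BA K t) * (Φf.wC K t a c * Real.exp (Φf.BV K t a h l c)) * (μ K).real Set.univ) := by
  set J := ℛ.runOf K a (h, l, c) with hJ
  -- (E1): the pointwise product bound per elementary term — the ONLY place the identification enters
  have hBx : ∀ x, |(Rp K t).eterm a (h, l, c) x| ≤
      (∏ j ∈ Finset.range (K + 1), ∏ c' ∈ J.histM.comp j, Φf.levelFactor J.histM J.rnwM K j c') *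
        (Real.exp (Φf.BA K t) * (Φf.wC K t a c * Real.exp (Φf.BV K t a h l c))) :=
    fun x => hE.eterm_le K t ht hK a (h, l, c) hι x
  -- (E1) integrated (M2-A): `|weight| ≤ (∏ levelFactor) · E · mass`, hence the right-hand side is NONNEGATIVE
  have hw := Repr172R.abs_weight_le μ Rp t K a (h, l, c) hBx
  have hP := Φf.prod_levelFactor_eq_pedM J hN hRm K
  -- abbreviations
  set VOLM := ∏ j ∈ Finset.range (K + 1), ∏ c' ∈ J.histM.comp j, Φf.Λ K j ^ (c'.2).card with hVOLM
  set EVM := (∏ c' ∈ J.histM.comp K, evProd (Φf.fB K) (Φf.fR K) (J.pedM.toPGen id (K, c'))) *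
    ∏ j ∈ Finset.range K, ∏ c' ∈ J.histM.died j, evProd (Φf.fB K) (Φf.fR K) (J.pedM.toPGen id (j, c')) with hEVM
  set E := Real.exp (Φf.BA K t) * (Φf.wC K t a c * Real.exp (Φf.BV K t a h l c)) * (μ K).real Set.univ with hE'
  have hVpos : 0 < VOLM :=
    Finset.prod_pos fun j _ => Finset.prod_pos fun c' _ => lt_of_lt_of_le zero_lt_one (Φf.one_le_Λ_pow K j _)
  -- `weight ≤ VOLM · EVM · E` and `0 ≤ VOLM · EVM · E`
  have h1 : Repr172R.weight μ Rp t ⟨K, a, (h, l, c)⟩ ≤ VOLM * EVM * E := by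
    have := (le_abs_self _).trans hw
    rw [hP] at this
    calc _ ≤ _ := this
      _ = _ := by rw [hE']; ring
  have h0 : 0 ≤ VOLM * EVM * E := by
    have := (abs_nonneg _).trans hw
    rw [hP] at this
    calc (0 : ℝ) ≤ _ := this
      _ = _ := by rw [hE']; ring
  have hEE : 0 ≤ EVM * E := by
    have h' : 0 ≤ VOLM * (EVM * E) := by rw [← mul_assoc]; exact h0
    exact (mul_nonneg_iff_of_pos_left hVpos).1 h'
  -- the volume factor along the pass-V forest AT WEIGHT `w` (the ledger a plug); the event products moved to `pedMV`
  have hV := prod_pow_card_le_live_mul_dead_of_plug (I := J) (C := C) hN hRm hRmS hRm2 hD hL0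
    (Λ := Φf.Λ K) (fun j => Φf.one_le_Λ K j) w hplug
  have hlive := prod_comp_evProd_pedMV hN hRm hRmS hRm2 hD hL0 (Φf.fB K) (Φf.fR K) K
  have hdead : ∏ j ∈ Finset.range K, ∏ x ∈ J.histV.died j, evProd (Φf.fB K) (Φf.fR K) (J.pedMV.toPGen id (j, x)) =
      ∏ j ∈ Finset.range K, ∏ x ∈ J.histM.died j, evProd (Φf.fB K) (Φf.fR K) (J.pedM.toPGen id (j, x)) :=
    Finset.prod_congr rfl fun j _ => prod_died_evProd_pedMV hN hRm hRmS hRm2 hD hL0 (Φf.fB K) (Φf.fR K) j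
  have h2 : VOLM * EVM * E ≤
      ((∏ x ∈ J.histV.comp K,
          Real.exp (lifeCost (dictWT Prod.fst J.R C.n₁) (costT Prod.fst C K J.R) (J.pedMV.genT (K, x))) *
            Real.exp (birthWT Prod.fst (fun n => w * Real.log (Φf.Λ K n)) (J.pedMV.genT (K, x)))) *
        ∏ j ∈ Finset.range K, ∏ x ∈ J.histV.died j,
          Real.exp (treeVol J.L J.s (fun v => (v : ℝ)) J.pedMV (fun j => Real.log (Φf.Λ K j)) j (j, x))) *
        EVM * E := by
    rw [mul_assoc, mul_assoc _ EVM E]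
    exact mul_le_mul_of_nonneg_right hV hEE
  have eq1 : (∏ x ∈ J.histV.comp K,
      Real.exp (lifeCost (dictWT Prod.fst J.R C.n₁) (costT Prod.fst C K J.R) (J.pedMV.genT (K, x))) *
        Real.exp (birthWT Prod.fst (fun n => w * Real.log (Φf.Λ K n)) (J.pedMV.genT (K, x))) *
        evProd (Φf.fB K) (Φf.fR K) (J.pedMV.toPGen id (K, x))) =
      (∏ x ∈ J.histV.comp K,
        Real.exp (lifeCost (dictWT Prod.fst J.R C.n₁) (costT Prod.fst C K J.R) (J.pedMV.genT (K, x))) *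
          Real.exp (birthWT Prod.fst (fun n => w * Real.log (Φf.Λ K n)) (J.pedMV.genT (K, x)))) *
        ∏ x ∈ J.histV.comp K, evProd (Φf.fB K) (Φf.fR K) (J.pedMV.toPGen id (K, x)) :=
    Finset.prod_mul_distrib
  have eq2 : (∏ j ∈ Finset.range K, ∏ x ∈ J.histV.died j,
      Real.exp (treeVol J.L J.s (fun v => (v : ℝ)) J.pedMV (fun j => Real.log (Φf.Λ K j)) j (j, x)) *
        evProd (Φf.fB K) (Φf.fR K) (J.pedMV.toPGen id (j, x))) =
      (∏ j ∈ Finset.range K, ∏ x ∈ J.histV.died j,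
        Real.exp (treeVol J.L J.s (fun v => (v : ℝ)) J.pedMV (fun j => Real.log (Φf.Λ K j)) j (j, x))) *
        ∏ j ∈ Finset.range K, ∏ x ∈ J.histV.died j, evProd (Φf.fB K) (Φf.fR K) (J.pedMV.toPGen id (j, x)) := by
    rw [← Finset.prod_mul_distrib]
    exact Finset.prod_congr rfl fun j _ => Finset.prod_mul_distrib
  refine h1.trans (h2.trans (le_of_eq ?_))
  rw [eq1, eq2, hEVM, ← hlive, ← hdead]
  ring

/-- **THE OWNER's THEOREM OF RECORD IS RECOVERED FROM `hR.etermRead`** (consistency, by the elaborator; an `example`, so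
that no landed statement is re-declared): §4 at `w := 2^{d+3}` with leaf-04's `plug_of_flat`, fed `hR.etermRead`, is
accepted AT THE TYPE of `B16HistoryWeightPlug.weight_le_live_mul_dead`, read off by `type_of%`. [folklore] -/
example [∀ K, MeasurableSpace (X K)] (μ : (K : ℕ) → Measure (X K)) [∀ K, IsFiniteMeasure (μ K)]
    (hR : HistRead ℛ Φf Rp l₀ K₀) {K : ℕ} (hK : K₀ ≤ K) {t : ℝ} (ht : |t| ≤ l₀)
    (a : (I K).Adm) {h : (I K).HZ} {l : (I K).HL} {c : (I K).HC} (hι : (h, l, c) ∈ (I K).LIdx a)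
    (hN : (ℛ.runOf K a (h, l, c)).NewOK)
    (hRm : ∀ t k, (ℛ.runOf K a (h, l, c)).Rm t k ≤ (ℛ.runOf K a (h, l, c)).R t)
    (hRmS : ∀ t k, (ℛ.runOf K a (h, l, c)).Rm t (k + 1) ≤ (ℛ.runOf K a (h, l, c)).R (t + 1))
    (hRm2 : ∀ t, 2 ≤ (ℛ.runOf K a (h, l, c)).Rm t 1) (hD : (ℛ.runOf K a (h, l, c)).NewDisjoint)
    (hL0 : 0 < (ℛ.runOf K a (h, l, c)).L) (hL4 : 4 ≤ (ℛ.runOf K a (h, l, c)).L)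
    (hdrop : ∀ m, DropCtl (ℛ.runOf K a (h, l, c)).s m) (hR1 : ∀ t, 1 ≤ (ℛ.runOf K a (h, l, c)).R t)
    {C : T4PrintedShapeBanking.Consts} (hn₁ : 13 ≤ C.n₁) (hE₂ : 0 ≤ C.E₂) (hE₃ : 0 ≤ C.E₃) {Lu : ℝ} (hLu0 : 0 < Lu)
    {j : ℕ} (hj1 : 1 ≤ j) (hLu : ∀ t i, i ≤ j → Real.log (Φf.Λ K (t + i)) ≤ Lu * Real.log (Φf.Λ K t))
    (hsmall : (1122 : ℝ) ^ d * 16 * 21 ^ d * Lu ≤ 2 ^ j / 2)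
    (huΦ : ∀ t, t ≤ K →
      Real.log (Φf.Λ K t) * (6 * (561 ^ d * j * Lu + 1122 ^ d * Lu)) ≤ floorK C K (ℛ.runOf K a (h, l, c)).R t)
    (huE₂ : ∀ n, n ≤ K → Real.log (Φf.Λ K n) * (15 * 126 ^ d) ≤ C.E₂ * ((ℛ.runOf K a (h, l, c)).R n : ℝ) ^ C.q')
    (huE₃ : ∀ n, n ≤ K → Real.log (Φf.Λ K n) * (24 * 126 ^ d) ≤ C.E₃ * ((ℛ.runOf K a (h, l, c)).R n : ℝ) ^ C.q') :
    type_of% (weight_le_live_mul_dead ℛ Φf μ Rp hR hK ht a hι hN hRm hRmS hRm2 hD hL0 hL4 hdrop hR1 hn₁ hE₂ hE₃ hLu0 hj1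
      hLu hsmall huΦ huE₂ huE₃) :=
  hR.etermRead.weight_le_live_mul_dead_of_plug μ hK ht a hι hN hRm hRmS hRm2 hD hL0 (C := C) (2 ^ (d + 3))
    (plug_of_flat hN hRm hRmS hRm2 hD hL0 hL4 hdrop hR1 hn₁ hE₂ hE₃ (fun j => Φf.one_le_Λ K j) hLu0 hj1 hLu hsmall huΦ
      huE₂ huE₃)

end EtermRead

end

end Summit.QuantumFields.BalabanUV.T4Continuum.B16HistoryEtermRead
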